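import Summits.HodgeConjecture.HodgeConjecture.Theorems.PadicSemiregularLiftHodgeFermatVarietiesPQSymmetric
import HarnessLib

/-!
# Hodge `(p+1)`-tuples of level `pq`, IV: the occupied fibre — line `cancel-by-any-claim-lattice`, crux `HodgeFermatVarieties` (stmt-HodgeConjecture-1334)

Fourth file of lead c3's LEVEL-`pq` programme (primes `5 ≤ p`, `p + 2 < q`): the second alternative of
`PQ.structure_units`. Let `s` be a Hodge multiset of `p + 1` elements of `ℤ/pq` and `b₁ ∈ (ℤ/q)ˣ` a residue
whose whole fibre `F = {x unit : x ≡ b₁ (q)}` (`p - 1` elements) is occupied, `c(x) ≥ c(-x) + 1` on `F`, and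
`c(x) = c(-x)` for the units off the fibres of `±b₁`.

* `fibre_le` — `F ≤ s` as multisets, so `s = F + s'` with `#s' = 2` (`exists_eq_fibre_add_pair`);
* `casts_sum_fibre` — `Σ F ≡ 0 (mod p)` (the residues of `F` run over `(ℤ/p)ˣ`) and `≡ (p-1) b₁ (mod q)`;
* `pair_level_q` — the two remaining entries `y, z` are of level `q` (zero mod `p`, non-zero mod `q`) with
  `ȳ + z̄ = (1 - p) b₁`: every other configuration contradicts the vanishing of `Σ s`, the congruences
  mod `q` (`k b₁ ≠ 0` for `0 < k ≤ p + 1 < q`) or the symmetry of the multiplicities off the fibres of `±b₁`.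
Word for word the level-`5q` file `FiveQFibre` with `5 ↦ p` (there `q ≥ 7` played the role of `q > p + 2`).

References: [Aoki1983] N. Aoki, Math. Ann. 266 (1983) Thm A′ (§7); [Aoki1987] J. Math. Soc. Japan 39 (1987)
§1 (standard elements).
-/

set_option linter.dupNamespace false

noncomputable section

open Finset
open Literature.AlgebraicGeometry.HodgeTheory Literature.AlgebraicGeometry.HodgeTheory.FermatCharacter
open Summit.HodgeConjecture.HodgeConjecture.Theorems.CancelByAnyClaimLattice.FiveQ

namespace Summit.HodgeConjecture.HodgeConjecture.Theorems.CancelByAnyClaimLattice.PQ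

/-! ### §0 Small multiples of a unit of `ℤ/q` -/

/-- `c b₁ ≠ 0` for `c ≠ 0` and a unit `b₁`. [folklore] -/
theorem coef_mul_ne_zero {q : ℕ} [Fact q.Prime] {c : ZMod q} (hc : c ≠ 0) (b₁ : (ZMod q)ˣ) : c * (b₁ : ZMod q) ≠ 0 :=
  mul_ne_zero hc (Units.ne_zero b₁)

/-- `p + 1 ≠ 0` in `ℤ/q` (`p + 1 < q`). [folklore] -/
theorem cast_add_one_ne_zero {p q : ℕ} (hpq' : p + 2 < q) : (p : ZMod q) + 1 ≠ 0 := by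
  have key : ((p + 1 : ℕ) : ZMod q) ≠ ((0 : ℕ) : ZMod q) := by
    intro h
    rw [ZMod.natCast_eq_natCast_iff', Nat.mod_eq_of_lt (by omega), Nat.mod_eq_of_lt (by omega)] at h
    omega
  push_cast at key
  exact key

/-- `p ≠ 0` in `ℤ/q` (`0 < p < q`). [folklore] -/
theorem cast_ne_zero' {p q : ℕ} [Fact p.Prime] (hpq' : p + 2 < q) : (p : ZMod q) ≠ 0 := by
  have hp0 : 0 < p := (Fact.out : p.Prime).pos
  have key : ((p : ℕ) : ZMod q) ≠ ((0 : ℕ) : ZMod q) := by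
    intro h
    rw [ZMod.natCast_eq_natCast_iff', Nat.mod_eq_of_lt (by omega), Nat.mod_eq_of_lt (by omega)] at h
    omega
  push_cast at key
  exact key

/-- `p - 1 ≠ 0` in `ℤ/q` (`2 ≤ p < q`). [folklore] -/
theorem cast_sub_one_ne_zero {p q : ℕ} [Fact p.Prime] (hpq' : p + 2 < q) : (p : ZMod q) - 1 ≠ 0 := by
  have hp2 : 2 ≤ p := (Fact.out : p.Prime).two_le
  have key : ((p : ℕ) : ZMod q) ≠ ((1 : ℕ) : ZMod q) := by
    intro h
    rw [ZMod.natCast_eq_natCast_iff', Nat.mod_eq_of_lt (by omega), Nat.mod_eq_of_lt (by omega)] at h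
    omega
  push_cast at key
  exact sub_ne_zero.mpr key

/-- `p - 2 ≠ 0` in `ℤ/q` (`2 < p < q`). [folklore] -/
theorem cast_sub_two_ne_zero {p q : ℕ} (hp : 5 ≤ p) (hpq' : p + 2 < q) : (p : ZMod q) - 2 ≠ 0 := by
  have key : ((p : ℕ) : ZMod q) ≠ ((2 : ℕ) : ZMod q) := by
    intro h
    rw [ZMod.natCast_eq_natCast_iff', Nat.mod_eq_of_lt (by omega), Nat.mod_eq_of_lt (by omega)] at h
    omega
  push_cast at key
  exact sub_ne_zero.mpr key

/-- `p - 3 ≠ 0` in `ℤ/q` (`3 < p < q`). [folklore] -/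
theorem cast_sub_three_ne_zero {p q : ℕ} (hp : 5 ≤ p) (hpq' : p + 2 < q) : (p : ZMod q) - 3 ≠ 0 := by
  have key : ((p : ℕ) : ZMod q) ≠ ((3 : ℕ) : ZMod q) := by
    intro h
    rw [ZMod.natCast_eq_natCast_iff', Nat.mod_eq_of_lt (by omega), Nat.mod_eq_of_lt (by omega)] at h
    omega
  push_cast at key
  exact sub_ne_zero.mpr key

/-- `2 ≠ 0` in `ℤ/q` (`2 < q`). [folklore] -/
theorem two_ne_zero' {p q : ℕ} (hpq' : p + 2 < q) : (2 : ZMod q) ≠ 0 := by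
  have key : ((2 : ℕ) : ZMod q) ≠ ((0 : ℕ) : ZMod q) := by
    intro h
    rw [ZMod.natCast_eq_natCast_iff', Nat.mod_eq_of_lt (by omega), Nat.mod_eq_of_lt (by omega)] at h
    omega
  push_cast at key
  exact key

/-- `2` is a unit of `ℤ/pq` (`p, q` odd). [folklore] -/
theorem isUnit_two {p q : ℕ} [Fact p.Prime] [Fact q.Prime] (hp : 5 ≤ p) (hpq' : p + 2 < q) :
    IsUnit (2 : ZMod (p * q)) := by
  have : ((2 : ℕ) : ZMod (p * q)) = 2 := by norm_cast
  rw [← this, ZMod.isUnit_iff_coprime, Nat.coprime_two_left]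
  exact Nat.odd_mul.mpr ⟨(Fact.out : p.Prime).odd_of_ne_two (by omega), (Fact.out : q.Prime).odd_of_ne_two (by omega)⟩

section LevelPQ

variable {p q : ℕ} [Fact p.Prime] [Fact q.Prime]

/-! ### §1 The occupied fibre as a sub-multiset -/

/-- The fibre of `b₁` as a multiset of residues: `{x unit : x ≡ b₁ (q)}` (`p - 1` elements). [folklore] -/
theorem card_fibreMultiset (hpq : p ≠ q) (b₁ : (ZMod q)ˣ) :
    Multiset.card ((univ.filter fun x : (ZMod (p * q))ˣ ↦ ZMod.unitsMap (dvd_mul_left q p) x = b₁).val.map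
      (fun x : (ZMod (p * q))ˣ ↦ (x : ZMod (p * q)))) = p - 1 := by
  rw [Multiset.card_map, Finset.card_val, card_fibre hpq b₁]

/-- Multiplicities of the fibre multiset: `1` at the units of the fibre, `0` elsewhere. [folklore] -/
theorem count_fibreMultiset (b₁ : (ZMod q)ˣ) (y : ZMod (p * q)) :
    Multiset.count y ((univ.filter fun x : (ZMod (p * q))ˣ ↦ ZMod.unitsMap (dvd_mul_left q p) x = b₁).val.map
      (fun x : (ZMod (p * q))ˣ ↦ (x : ZMod (p * q)))) =
      if ∃ x : (ZMod (p * q))ˣ, (x : ZMod (p * q)) = y ∧ ZMod.unitsMap (dvd_mul_left q p) x = b₁ then 1 else 0 := by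
  classical
  split_ifs with h
  · obtain ⟨x, rfl, hx⟩ := h
    rw [Multiset.count_map_eq_count' _ _ Units.val_injective, Multiset.count_eq_one_of_mem]
    · exact Finset.nodup _
    · simp [hx]
  · rw [Multiset.count_eq_zero]
    intro hy
    obtain ⟨x, hx, rfl⟩ := Multiset.mem_map.mp hy
    simp only [Finset.mem_val, mem_filter, mem_univ, true_and] at hx
    exact h ⟨x, rfl, hx⟩

/-- **The occupied fibre is a sub-multiset of `s`.** [folklore] -/
theorem fibre_le {s : Multiset (ZMod (p * q))} {b₁ : (ZMod q)ˣ}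
    (hocc : ∀ x : (ZMod (p * q))ˣ, ZMod.unitsMap (dvd_mul_left q p) x = b₁ →
      Multiset.count (-(x : ZMod (p * q))) s + 1 ≤ Multiset.count (x : ZMod (p * q)) s) :
    (univ.filter fun x : (ZMod (p * q))ˣ ↦ ZMod.unitsMap (dvd_mul_left q p) x = b₁).val.map
      (fun x : (ZMod (p * q))ˣ ↦ (x : ZMod (p * q))) ≤ s := by
  classical
  rw [Multiset.le_iff_count]
  intro y
  rw [count_fibreMultiset]
  split_ifs with h
  · obtain ⟨x, rfl, hx⟩ := h
    have := hocc x hx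
    omega
  · exact Nat.zero_le _

/-- **`s = F + {y, z}`.** [folklore] -/
theorem exists_eq_fibre_add_pair (hpq : p ≠ q) {s : Multiset (ZMod (p * q))} (h6 : Multiset.card s = p + 1)
    {b₁ : (ZMod q)ˣ}
    (hocc : ∀ x : (ZMod (p * q))ˣ, ZMod.unitsMap (dvd_mul_left q p) x = b₁ →
      Multiset.count (-(x : ZMod (p * q))) s + 1 ≤ Multiset.count (x : ZMod (p * q)) s) :
    ∃ y z : ZMod (p * q), s = (univ.filter fun x : (ZMod (p * q))ˣ ↦ ZMod.unitsMap (dvd_mul_left q p) x = b₁).val.map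
      (fun x : (ZMod (p * q))ˣ ↦ (x : ZMod (p * q))) + {y, z} := by
  obtain ⟨t, ht⟩ := Multiset.le_iff_exists_add.mp (fibre_le hocc)
  have hp2 : 2 ≤ p := (Fact.out : p.Prime).two_le
  have hcard : Multiset.card t = 2 := by
    have := congrArg Multiset.card ht
    rw [Multiset.card_add, card_fibreMultiset hpq, h6] at this
    omega
  obtain ⟨y, z, rfl⟩ := Multiset.card_eq_two.mp hcard
  exact ⟨y, z, ht⟩

/-! ### §2 The sum of the fibre -/

/-- The units of `ℤ/p` sum to zero (`p ≠ 2`). [folklore] -/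
theorem sum_units_coe_eq_zero (hp : 5 ≤ p) : ∑ a : (ZMod p)ˣ, ((a : (ZMod p)ˣ) : ZMod p) = 0 := by
  classical
  have h := FiniteField.sum_pow_units (ZMod p) 1
  simp only [pow_one] at h
  rw [h, ZMod.card, if_neg]
  intro hd
  have := Nat.le_of_dvd one_pos hd
  omega

/-- **`Σ F ≡ 0 (mod p)`** (the residues of the fibre run over `(ℤ/p)ˣ`, which sums to `0`) **and
`Σ F ≡ (p - 1) b₁ (mod q)`**. [folklore] -/
theorem casts_sum_fibre (hp : 5 ≤ p) (hpq : p ≠ q) (b₁ : (ZMod q)ˣ) :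
    ZMod.castHom (dvd_mul_right p q) (ZMod p)
        (((univ.filter fun x : (ZMod (p * q))ˣ ↦ ZMod.unitsMap (dvd_mul_left q p) x = b₁).val.map
          (fun x : (ZMod (p * q))ˣ ↦ (x : ZMod (p * q)))).sum) = 0 ∧
      ZMod.castHom (dvd_mul_left q p) (ZMod q)
        (((univ.filter fun x : (ZMod (p * q))ˣ ↦ ZMod.unitsMap (dvd_mul_left q p) x = b₁).val.map
          (fun x : (ZMod (p * q))ˣ ↦ (x : ZMod (p * q)))).sum) = ((p : ZMod q) - 1) * (b₁ : ZMod q) := by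
  constructor
  · rw [_root_.map_multiset_sum, Multiset.map_map, ← Finset.sum_eq_multiset_sum]
    have h := sum_fibre_eq_sum_units hpq b₁ (fun a : (ZMod p)ˣ ↦ ((a : (ZMod p)ˣ) : ZMod p))
    have h' : ∑ x ∈ univ.filter (fun x : (ZMod (p * q))ˣ ↦ ZMod.unitsMap (dvd_mul_left q p) x = b₁),
        (ZMod.castHom (dvd_mul_right p q) (ZMod p)) ((fun x : (ZMod (p * q))ˣ ↦ (x : ZMod (p * q))) x) =
        ∑ x ∈ univ.filter (fun x : (ZMod (p * q))ˣ ↦ ZMod.unitsMap (dvd_mul_left q p) x = b₁),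
          ((ZMod.unitsMap (dvd_mul_right p q) x : (ZMod p)ˣ) : ZMod p) :=
      Finset.sum_congr rfl fun x _ ↦ by rw [coe_unitsMap]
    rw [Function.comp_def, h', h]
    exact sum_units_coe_eq_zero hp
  · rw [_root_.map_multiset_sum, Multiset.map_map, ← Finset.sum_eq_multiset_sum]
    have h' : ∀ x ∈ univ.filter (fun x : (ZMod (p * q))ˣ ↦ ZMod.unitsMap (dvd_mul_left q p) x = b₁),
        (ZMod.castHom (dvd_mul_left q p) (ZMod q) ∘ fun x : (ZMod (p * q))ˣ ↦ (x : ZMod (p * q))) x = (b₁ : ZMod q) := by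
      intro x hx
      simp only [mem_filter, mem_univ, true_and] at hx
      rw [Function.comp_apply, ← coe_unitsMap, hx]
    have hp1 : 1 ≤ p := (Fact.out : p.Prime).one_le
    rw [Finset.sum_congr rfl h', Finset.sum_const, card_fibre hpq b₁, nsmul_eq_mul, Nat.cast_sub hp1, Nat.cast_one]

/-! ### §3 The two remaining entries are of level `q` -/

/-- **Multiplicity of a unit in `s = F + {y, z}`.** [folklore] -/
theorem count_unit_eq {s : Multiset (ZMod (p * q))} {b₁ : (ZMod q)ˣ} {y z : ZMod (p * q)}
    (hs : s = (univ.filter fun x : (ZMod (p * q))ˣ ↦ ZMod.unitsMap (dvd_mul_left q p) x = b₁).val.map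
      (fun x : (ZMod (p * q))ˣ ↦ (x : ZMod (p * q))) + {y, z}) (w : (ZMod (p * q))ˣ) :
    Multiset.count (w : ZMod (p * q)) s =
      (if ZMod.unitsMap (dvd_mul_left q p) w = b₁ then 1 else 0) + Multiset.count (w : ZMod (p * q)) {y, z} := by
  classical
  rw [hs, Multiset.count_add, count_fibreMultiset]
  congr 1
  by_cases hw : ZMod.unitsMap (dvd_mul_left q p) w = b₁
  · rw [if_pos hw, if_pos ⟨w, rfl, hw⟩]
  · rw [if_neg hw, if_neg]
    rintro ⟨x, hx, hxb⟩
    exact hw (by rw [← Units.val_injective hx]; exact hxb)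

/-- **A unit entry outside the fibres of `±b₁` whose negative is not an entry is impossible** (its
multiplicity would be symmetric). Technical form used twice below. [folklore] -/
theorem false_of_unit_off (hp : 5 ≤ p) (hpq' : p + 2 < q) {s : Multiset (ZMod (p * q))} {b₁ : (ZMod q)ˣ}
    {y z : ZMod (p * q)}
    (hs : s = (univ.filter fun x : (ZMod (p * q))ˣ ↦ ZMod.unitsMap (dvd_mul_left q p) x = b₁).val.map
      (fun x : (ZMod (p * q))ˣ ↦ (x : ZMod (p * q))) + {y, z})
    (hoff : ∀ x : (ZMod (p * q))ˣ, ZMod.unitsMap (dvd_mul_left q p) x ≠ b₁ → ZMod.unitsMap (dvd_mul_left q p) x ≠ -b₁ →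
      Multiset.count (x : ZMod (p * q)) s = Multiset.count (-(x : ZMod (p * q))) s)
    (hsum : ZMod.castHom (dvd_mul_left q p) (ZMod q) y + ZMod.castHom (dvd_mul_left q p) (ZMod q) z =
      (1 - (p : ZMod q)) * (b₁ : ZMod q))
    (w : (ZMod (p * q))ˣ) (hwy : (w : ZMod (p * q)) = y)
    (h1 : ZMod.unitsMap (dvd_mul_left q p) w ≠ b₁) (h2 : ZMod.unitsMap (dvd_mul_left q p) w ≠ -b₁) : False := by
  classical
  have hc := hoff w h1 h2
  rw [count_unit_eq hs w, if_neg h1, zero_add] at hc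
  have hcw : 0 < Multiset.count (w : ZMod (p * q)) ({y, z} : Multiset (ZMod (p * q))) :=
    Multiset.count_pos.mpr (by simp [hwy])
  -- so `-w` occurs in `s`; it is a unit off the fibres of `±b₁`, hence in `{y, z}`, hence `-w = z`
  have hnw : ZMod.unitsMap (dvd_mul_left q p) (-w) ≠ b₁ := by rw [unitsMap_neg]; exact fun h ↦ h2 (by rw [← h, neg_neg])
  have hc' := count_unit_eq hs (-w)
  rw [if_neg hnw, zero_add, Units.val_neg] at hc'
  rw [hc'] at hc
  have hmem : -(w : ZMod (p * q)) ∈ ({y, z} : Multiset (ZMod (p * q))) := Multiset.count_pos.mp (by omega)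
  simp only [Multiset.insert_eq_cons, Multiset.mem_cons, Multiset.mem_singleton] at hmem
  have hwz : -(w : ZMod (p * q)) = z := by
    rcases hmem with h | h
    · -- `-w = y = w`: then `2w = 0`, impossible for a unit of odd modulus
      exfalso
      rw [← hwy] at h
      have h2 : (2 : ZMod (p * q)) * (w : ZMod (p * q)) = 0 := by linear_combination -h
      haveI : Fact (1 < p * q) := ⟨lt_of_lt_of_le (by omega : 1 < p) (Nat.le_mul_of_pos_right p (by omega))⟩
      exact (Units.ne_zero w) (((isUnit_two hp hpq').mul_right_eq_zero).mp h2)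
    · exact h
  -- then `ȳ + z̄ = 0 ≠ (1 - p) b₁`
  rw [← hwy, ← hwz, map_neg, add_neg_cancel] at hsum
  refine coef_mul_ne_zero (cast_sub_one_ne_zero hpq') b₁ ?_
  linear_combination hsum

/-- **The entry `y` of `s = F + {y, z}` is not a unit** (given the sum conditions and the symmetry off
the fibres of `±b₁`). [folklore] -/
theorem not_isUnit_of_pair (hp : 5 ≤ p) (hpq' : p + 2 < q) {s : Multiset (ZMod (p * q))} (hs0 : ∀ x ∈ s, x ≠ 0)
    {b₁ : (ZMod q)ˣ} {y z : ZMod (p * q)}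
    (hs : s = (univ.filter fun x : (ZMod (p * q))ˣ ↦ ZMod.unitsMap (dvd_mul_left q p) x = b₁).val.map
      (fun x : (ZMod (p * q))ˣ ↦ (x : ZMod (p * q))) + {y, z})
    (hoff : ∀ x : (ZMod (p * q))ˣ, ZMod.unitsMap (dvd_mul_left q p) x ≠ b₁ → ZMod.unitsMap (dvd_mul_left q p) x ≠ -b₁ →
      Multiset.count (x : ZMod (p * q)) s = Multiset.count (-(x : ZMod (p * q))) s)
    (hsump : ZMod.castHom (dvd_mul_right p q) (ZMod p) y + ZMod.castHom (dvd_mul_right p q) (ZMod p) z = 0)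
    (hsum : ZMod.castHom (dvd_mul_left q p) (ZMod q) y + ZMod.castHom (dvd_mul_left q p) (ZMod q) z =
      (1 - (p : ZMod q)) * (b₁ : ZMod q)) :
    ¬ IsUnit y := by
  classical
  have hpq : p ≠ q := by omega
  intro hyu
  set w := hyu.unit with hw
  have hwy : (w : ZMod (p * q)) = y := hyu.unit_spec
  have hz0 : z ≠ 0 := hs0 z (by rw [hs]; simp)
  -- `w` lies in the fibre of `b₁` or of `-b₁` (else `false_of_unit_off`)
  by_cases h1 : ZMod.unitsMap (dvd_mul_left q p) w = b₁
  · -- then `z̄ = (1 - p) b₁ - b₁ = -p b₁`; analyse `z`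
    have hyq : ZMod.castHom (dvd_mul_left q p) (ZMod q) y = b₁ := by rw [← hwy, ← coe_unitsMap, h1]
    have hzq : ZMod.castHom (dvd_mul_left q p) (ZMod q) z = -((p : ZMod q) * (b₁ : ZMod q)) := by
      rw [hyq] at hsum; linear_combination hsum
    rcases trichotomy hpq hz0 with hzu | ⟨hzp, -⟩ | ⟨-, hzq0⟩
    · -- `z` unit: in the fibre of `b₁` or `-b₁` or off them
      set v := hzu.unit with hv
      have hvz : (v : ZMod (p * q)) = z := hzu.unit_spec
      by_cases g1 : ZMod.unitsMap (dvd_mul_left q p) v = b₁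
      · -- `z̄ = b₁ = -p b₁`: `(p + 1) b₁ = 0`
        have : ZMod.castHom (dvd_mul_left q p) (ZMod q) z = b₁ := by rw [← hvz, ← coe_unitsMap, g1]
        rw [this] at hzq
        exact coef_mul_ne_zero (cast_add_one_ne_zero hpq') b₁ (by linear_combination hzq)
      by_cases g2 : ZMod.unitsMap (dvd_mul_left q p) v = -b₁
      · -- `z̄ = -b₁ = -p b₁`: `(p - 1) b₁ = 0`
        have : ZMod.castHom (dvd_mul_left q p) (ZMod q) z = -(b₁ : ZMod q) := by
          rw [← hvz, ← coe_unitsMap, g2, Units.val_neg]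
        rw [this] at hzq
        exact coef_mul_ne_zero (cast_sub_one_ne_zero hpq') b₁ (by linear_combination hzq)
      · -- `z` off the fibres: symmetric argument with the roles of `y`, `z` exchanged
        have hs' : s = (univ.filter fun x : (ZMod (p * q))ˣ ↦ ZMod.unitsMap (dvd_mul_left q p) x = b₁).val.map
            (fun x : (ZMod (p * q))ˣ ↦ (x : ZMod (p * q))) + {z, y} := by rw [hs, Multiset.pair_comm]
        exact false_of_unit_off hp hpq' hs' hoff (by rw [add_comm]; exact hsum) v hvz g1 g2
    · -- `z` of level `q`: `z ≡ 0 (p)` forces `y ≡ 0 (p)`, but `y` is a unit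
      rw [hzp, add_zero] at hsump
      exact cast_ne_zero_of_isUnit' hyu hsump
    · -- `z` of level `p`: `z̄ = 0 = -p b₁`, impossible
      rw [hzq0] at hzq
      exact coef_mul_ne_zero (cast_ne_zero' hpq') b₁ (by linear_combination hzq)
  by_cases h2 : ZMod.unitsMap (dvd_mul_left q p) w = -b₁
  · -- then `z̄ = (1 - p) b₁ + b₁ = (2 - p) b₁`
    have hyq : ZMod.castHom (dvd_mul_left q p) (ZMod q) y = -(b₁ : ZMod q) := by
      rw [← hwy, ← coe_unitsMap, h2, Units.val_neg]
    have hzq : ZMod.castHom (dvd_mul_left q p) (ZMod q) z = (2 - (p : ZMod q)) * (b₁ : ZMod q) := by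
      rw [hyq] at hsum; linear_combination hsum
    rcases trichotomy hpq hz0 with hzu | ⟨hzp, -⟩ | ⟨-, hzq0⟩
    · set v := hzu.unit with hv
      have hvz : (v : ZMod (p * q)) = z := hzu.unit_spec
      by_cases g1 : ZMod.unitsMap (dvd_mul_left q p) v = b₁
      · -- `b₁ = (2 - p) b₁`: `(p - 1) b₁ = 0`
        have : ZMod.castHom (dvd_mul_left q p) (ZMod q) z = b₁ := by rw [← hvz, ← coe_unitsMap, g1]
        rw [this] at hzq
        exact coef_mul_ne_zero (cast_sub_one_ne_zero hpq') b₁ (by linear_combination hzq)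
      by_cases g2 : ZMod.unitsMap (dvd_mul_left q p) v = -b₁
      · -- `-b₁ = (2 - p) b₁`: `(p - 3) b₁ = 0`
        have : ZMod.castHom (dvd_mul_left q p) (ZMod q) z = -(b₁ : ZMod q) := by
          rw [← hvz, ← coe_unitsMap, g2, Units.val_neg]
        rw [this] at hzq
        exact coef_mul_ne_zero (cast_sub_three_ne_zero hp hpq') b₁ (by linear_combination hzq)
      · have hs' : s = (univ.filter fun x : (ZMod (p * q))ˣ ↦ ZMod.unitsMap (dvd_mul_left q p) x = b₁).val.map
            (fun x : (ZMod (p * q))ˣ ↦ (x : ZMod (p * q))) + {z, y} := by rw [hs, Multiset.pair_comm]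
        exact false_of_unit_off hp hpq' hs' hoff (by rw [add_comm]; exact hsum) v hvz g1 g2
    · rw [hzp, add_zero] at hsump
      exact cast_ne_zero_of_isUnit' hyu hsump
    · -- `z̄ = 0 = (2 - p) b₁`: `(p - 2) b₁ = 0`
      rw [hzq0] at hzq
      exact coef_mul_ne_zero (cast_sub_two_ne_zero hp hpq') b₁ (by linear_combination hzq)
  · exact false_of_unit_off hp hpq' hs hoff hsum w hwy h1 h2

/-- **THE TWO REMAINING ENTRIES ARE OF LEVEL `q`**: `y ≡ z ≡ 0 (mod p)`, `ȳ, z̄ ≠ 0`, `ȳ + z̄ = (1 - p) b₁`.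
[cite: Aoki1983, Thm. A′ (§7)] -/
theorem pair_level_q_pq : ∀ {p q : ℕ} [Fact p.Prime] [Fact q.Prime], 5 ≤ p → p + 2 < q →
    ∀ {s : Multiset (ZMod (p * q))}, IsHodgeMultiset s →
    ∀ {b₁ : (ZMod q)ˣ} {y z : ZMod (p * q)},
    s = (univ.filter fun x : (ZMod (p * q))ˣ ↦ ZMod.unitsMap (dvd_mul_left q p) x = b₁).val.map
      (fun x : (ZMod (p * q))ˣ ↦ (x : ZMod (p * q))) + {y, z} →
    (∀ x : (ZMod (p * q))ˣ, ZMod.unitsMap (dvd_mul_left q p) x ≠ b₁ → ZMod.unitsMap (dvd_mul_left q p) x ≠ -b₁ →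
      Multiset.count (x : ZMod (p * q)) s = Multiset.count (-(x : ZMod (p * q))) s) →
    ZMod.castHom (dvd_mul_right p q) (ZMod p) y = 0 ∧ ZMod.castHom (dvd_mul_right p q) (ZMod p) z = 0 ∧
      ZMod.castHom (dvd_mul_left q p) (ZMod q) y ≠ 0 ∧ ZMod.castHom (dvd_mul_left q p) (ZMod q) z ≠ 0 ∧
      ZMod.castHom (dvd_mul_left q p) (ZMod q) y + ZMod.castHom (dvd_mul_left q p) (ZMod q) z =
        (1 - (p : ZMod q)) * (b₁ : ZMod q) := by
  intro p q _ _ hp hpq' s hs b₁ y z hsyz hoff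
  classical
  have hpq : p ≠ q := by omega
  -- the sum of `s` vanishes: `y + z = -Σ F`
  have hsum0 : ((univ.filter fun x : (ZMod (p * q))ˣ ↦ ZMod.unitsMap (dvd_mul_left q p) x = b₁).val.map
      (fun x : (ZMod (p * q))ˣ ↦ (x : ZMod (p * q)))).sum + (y + z) = 0 := by
    have := hs.1.2
    rw [hsyz, Multiset.sum_add] at this
    simpa using this
  obtain ⟨hFp, hFq⟩ := casts_sum_fibre hp hpq b₁
  have hsump : ZMod.castHom (dvd_mul_right p q) (ZMod p) y + ZMod.castHom (dvd_mul_right p q) (ZMod p) z = 0 := by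
    have := congrArg (ZMod.castHom (dvd_mul_right p q) (ZMod p)) hsum0
    rw [map_add, map_add, hFp, map_zero, zero_add] at this
    exact this
  have hsumq : ZMod.castHom (dvd_mul_left q p) (ZMod q) y + ZMod.castHom (dvd_mul_left q p) (ZMod q) z =
      (1 - (p : ZMod q)) * (b₁ : ZMod q) := by
    have := congrArg (ZMod.castHom (dvd_mul_left q p) (ZMod q)) hsum0
    rw [map_add, map_add, hFq, map_zero] at this
    linear_combination this
  have hs0 := hs.1.1
  have hy : ¬ IsUnit y := not_isUnit_of_pair hp hpq' hs0 hsyz hoff hsump hsumq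
  have hsyz' : s = (univ.filter fun x : (ZMod (p * q))ˣ ↦ ZMod.unitsMap (dvd_mul_left q p) x = b₁).val.map
      (fun x : (ZMod (p * q))ˣ ↦ (x : ZMod (p * q))) + {z, y} := by rw [hsyz, Multiset.pair_comm]
  have hz : ¬ IsUnit z := not_isUnit_of_pair hp hpq' hs0 hsyz' hoff (by rw [add_comm]; exact hsump)
    (by rw [add_comm]; exact hsumq)
  have hy0 : y ≠ 0 := hs0 y (by rw [hsyz]; simp)
  have hz0 : z ≠ 0 := hs0 z (by rw [hsyz]; simp)
  -- neither is of level `p`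
  rcases trichotomy hpq hy0 with hyu | ⟨hyp, hyq⟩ | ⟨hyp, hyq⟩
  · exact absurd hyu hy
  · rcases trichotomy hpq hz0 with hzu | ⟨hzp, hzq⟩ | ⟨hzp, hzq⟩
    · exact absurd hzu hz
    · exact ⟨hyp, hzp, hyq, hzq, hsumq⟩
    · -- `z` level `p`: then `y ≡ -z ≢ 0 (p)` — but `y ≡ 0 (p)`
      exfalso
      rw [hyp, zero_add] at hsump
      exact hzp hsump
  · exfalso
    rcases trichotomy hpq hz0 with hzu | ⟨hzp, -⟩ | ⟨-, hzq⟩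
    · exact absurd hzu hz
    · rw [hzp, add_zero] at hsump; exact hyp hsump
    · -- both of level `p`: `0 = (1 - p) b₁`
      rw [hyq, hzq, zero_add] at hsumq
      exact coef_mul_ne_zero (cast_sub_one_ne_zero hpq') b₁ (by linear_combination hsumq)

end LevelPQ

end Summit.HodgeConjecture.HodgeConjecture.Theorems.CancelByAnyClaimLattice.PQ
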